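import Mathlib.Analysis.Calculus.MeanValue
import Literature.Barriers.CriticalPhenomena.WeaklySAWCouplingFlowComparison
import Literature.Barriers.CriticalPhenomena.WeaklySAWCouplingFlowCutoffDeriv
import Literature.Barriers.CriticalPhenomena.WeaklySAWQuadraticFlowCutoff
import HarnessLib

/-!
# [BBS-rg-flow, Lemma 2.1(iv) and Lemma 2.3 (Lipschitz form)]: dependence of the quadratic flow
# `V̄ = (ḡ, z̄, μ̄)` on its initial condition `g₀`

Seventh file of the series formalising [BBS-rg-flow] (Bauerschmidt–Brydges–Slade, AHP 16 (2015),
arXiv:1211.2477), the abstract dynamical-system input of BBS 2015, Theorem 4.1 (via its Theorem 7.2.1),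
towards `Literature.Barriers.CriticalPhenomena.WeaklySAWFourDimLogCorrections`; continuation of
`WeaklySAWQuadraticFlowCutoff.lean` (`P.flow g₀ = (ḡ, z̄, μ̄)`, hypotheses `CutoffQuadHyp`) and
`WeaklySAWCouplingFlowCutoffDeriv.lean` (`ḡ_j' = ∏(1-2β_lḡ_l) ∈ (ḡ_j/g₀)²[1 - O(g₀), 1]`).

Lemma 3.4 of the source needs the flow `x̄` of `Φ̄` to depend continuously on the initial condition in
the weighted norm `X^𝗐` ((3.2)), which for the `𝒱`-components is Lemma 2.3: `V̄_j' = O(χ_jḡ_j²/ḡ₀²)`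
((2.33)). This file proves (2.33) in LIPSCHITZ form — which is all Lemma 3.4 and Theorem 1.4(i) use —
following the structure of the printed proof but replacing the termwise differentiation of the
series (2.14), (2.19) by the observation that the DIFFERENCE of two flows solves the same linear
recursions as the derivative, with the same type of source, so that the backward-solution bounds
of Lemma 2.2 apply verbatim:
* `CutoffGbarHyp.mono`, `CutoffQuadHyp.mono`: the hypotheses persist for smaller `g₀`;
* **Lemma 2.1(iv)** in the printed generality (`abs_gbar_sub_gbar_le_init`): `|g̊₀ - ḡ₀| ≤ δg̊₀`
  implies `|g̊_j - ḡ_j| ≤ 2δg̊_j` for all `j` ((2.8); the factor `1 + O(ḡ₀)` made `2`);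
* `abs_gbar_sub_gbar_le_sq`: `|ḡ_j(g₀) - ḡ_j(g̊₀)| ≤ 9(g̊_j²/g̊₀²)|g₀ - g̊₀|` for `|g₀ - g̊₀| ≤ g̊₀/4` — (2.33)
  for `ḡ`, from (2.36) along the segment and the mean value inequality;
* `QuadFlowParams.bwdZ`, `QuadFlowParams.bwdMu`: the decaying solution of
  `d_{j+1} = (1-ζ_jḡ_j)d_j + e_j` for `|e_l| ≤ Eχ_lḡ_l³` and the bounded solution of
  `m_{j+1} = (λ_j-τ_j)m_j + f_j` for `|f_l| ≤ Fχ_lḡ_l²`, with recursions, bounds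
  `|d_j| ≤ 4EC_{2,0}χ_jḡ_j²`, `|m_j| ≤ (8F/(λ-1))χ_jḡ_j²`, and UNIQUENESS (`bwdZ_unique`: homogeneous
  solutions do not decay, Lemma 2.1(iii)(b); `bwdMu_unique`: the direction expands) — the mechanism
  of (2.14)–(2.21) and (2.37)–(2.40) for general sources;
* `abs_zbar_sub_zbar_le`, `abs_mubar_sub_mubar_le`: (2.33) for `z̄, μ̄`:
  `|z̄_j(g) - z̄_j(g̊₀)| ≤ K_zχ_jg̊_j²|g - g̊₀|/g̊₀²`, `|μ̄_j(g) - μ̄_j(g̊₀)| ≤ K_μχ_jg̊_j²|g - g̊₀|/g̊₀²`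
  (`zLipConst`, `muLipConst`, depending only on `(Ω, c, N, C, λ)`), for admissible `g, g̊₀` with
  `|g - g̊₀| ≤ g̊₀/4` and the smallness `8B²C_{2,0}max{g, g̊₀} ≤ 1`.

Deliberately NOT here: the derivatives proper and the second derivatives of (2.33)–(2.34) (needed
only for Theorem 1.4(ii) and the `C¹` statements of Lemma 3.4), continuity in an external parameter.

## References
* R. Bauerschmidt, D. C. Brydges, G. Slade, *Structural stability of a dynamical system near a
  non-hyperbolic fixed point*, Ann. Henri Poincaré 16 (2015), arXiv:1211.2477: Lemma 2.1(iv) (2.8),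
  Lemma 2.2 (2.14)–(2.21), Lemma 2.3 (2.33), (2.36)–(2.40), Lemma 3.4 (3.14). [BauerschmidtBrydgesSlade2015Flow]
-/

noncomputable section

open Filter Topology Set
open scoped BigOperators

namespace Literature.Barriers.CriticalPhenomena

namespace CTWSAW

/-! ## [BBS-rg-flow, Lemma 2.1(iv) and Lemma 2.3 (Lipschitz form)]: dependence of `ḡ_j` on the
initial condition `g₀` -/

namespace CutoffGbarHyp

variable {β : ℕ → ℝ} {Ω : ℝ} {k : ℕ∞} {B c : ℝ} {N : ℕ} {g₀ : ℝ} (h : CutoffGbarHyp β Ω k B c N g₀)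
include h

/-- The hypotheses are monotone in `g₀`: they persist for every smaller positive initial condition.
[cite: BauerschmidtBrydgesSlade2015Flow, Lemma 2.1 ("if ḡ₀ > 0 is sufficiently small")] -/
theorem mono {g : ℝ} (hg : 0 < g) (hle : g ≤ g₀) : CutoffGbarHyp β Ω k B c N g := by
  have hB := h.B_nonneg
  have hx : 0 ≤ (N : ℝ) + 1 / (Ω - 1) := by
    have : 0 ≤ 1 / (Ω - 1) := div_nonneg zero_le_one (by linarith [h.one_lt]); positivity
  refine ⟨h.one_lt, h.abs_le, h.c_pos, h.exc, hg, hle.trans h.g₀_le, ?_, ?_⟩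
  · exact (mul_le_mul_of_nonneg_left hle hB).trans h.smallB
  · calc 2 * B * g * (N + 1 / (Ω - 1)) ≤ 2 * B * g₀ * (N + 1 / (Ω - 1)) := by gcongr
      _ ≤ 1 / 2 := h.smallN

/-- **[BBS-rg-flow, Lemma 2.1(iv)]** with explicit constant: for two initial conditions `g₀, g̊₀`
(both admissible) with `|g̊₀ - g₀| ≤ δg̊₀`, `|g̊_j - ḡ_j| ≤ 2δ g̊_j` for all `j`
("`|g̊_j - ḡ_j| ≤ δg̊_j(1 + O(ḡ₀))`": the recursion (2.8) `δ_{j+1} = δ_j(1 - β_jḡ_j/(1 - β_jg̊_j))` is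
non-increasing on the scales with `β_j ≥ 0`, and the other scales cost a factor `≤ 2`).
[cite: BauerschmidtBrydgesSlade2015Flow, Lemma 2.1(iv), (2.8) and its proof] -/
theorem abs_gbar_sub_gbar_le_init {g' : ℝ} (h' : CutoffGbarHyp β Ω k B c N g') {δ : ℝ} (hδ : 0 ≤ δ)
    (h0 : |g' - g₀| ≤ δ * g') (j : ℕ) : |gbar β g' j - gbar β g₀ j| ≤ 2 * δ * gbar β g' j := by
  classical
  -- `r_j = |g̊_j - ḡ_j|/g̊_j` satisfies `r_{j+1} = r_j F_j`, `F_j ≤ 1 + (-β_j)₊ḡ_j`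
  set a : ℕ → ℝ := fun l => max (-β l) 0 * gbar β g₀ l with ha
  have ha0 : ∀ l, 0 ≤ a l := fun l => mul_nonneg (le_max_right _ _) (h.gbar_pos l).le
  -- claim by induction: `|g̊_j - ḡ_j| ≤ δ g̊_j ∏_{l<j} (1 + a_l)`
  have key : ∀ j, |gbar β g' j - gbar β g₀ j| ≤ δ * gbar β g' j * ∏ l ∈ Finset.range j, (1 + a l) := by
    intro j
    induction j with
    | zero => simpa using h0
    | succ j ih =>
      rw [GbarHyp.gbar_sub_gbar_succ β g₀ g' j, abs_mul, Finset.prod_range_succ, gbar_succ' β g']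
      have hgj := h.gbar_pos j; have hgj' := h'.gbar_pos j
      have hb := h.abs_beta_mul_gbar_le_half j; have hb' := h'.abs_beta_mul_gbar_le_half j
      have hβg : |β j * gbar β g₀ j| ≤ 1 / 2 := by rwa [abs_mul, abs_of_pos hgj]
      have hβg' : |β j * gbar β g' j| ≤ 1 / 2 := by rwa [abs_mul, abs_of_pos hgj']
      -- the factor `1 - β_j(g̊_j + ḡ_j) ≥ 0`
      have hF0 : 0 ≤ 1 - β j * (gbar β g' j + gbar β g₀ j) := by
        nlinarith [neg_abs_le (β j * gbar β g₀ j), neg_abs_le (β j * gbar β g' j),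
          le_abs_self (β j * gbar β g₀ j), le_abs_self (β j * gbar β g' j)]
      rw [abs_of_nonneg hF0]
      -- `1 - β_j(g̊_j + ḡ_j) ≤ (1 - β_jg̊_j)(1 + a_j)`
      have hfac : 1 - β j * (gbar β g' j + gbar β g₀ j) ≤ (1 - β j * gbar β g' j) * (1 + a j) := by
        have h1 : 0 ≤ 1 - β j * gbar β g' j := by linarith [(h'.one_sub_mem j).1]
        rcases le_or_gt 0 (β j) with hβ | hβ
        · have : a j = 0 := by simp [ha, max_eq_right (neg_nonpos.2 hβ)]
          rw [this, add_zero, mul_one]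
          nlinarith [mul_nonneg hβ hgj.le]
        · have : a j = -β j * gbar β g₀ j := by simp [ha, max_eq_left (neg_nonneg.2 hβ.le)]
          rw [this]
          nlinarith [mul_nonneg (mul_nonneg (neg_nonneg.2 hβ.le) hgj.le)
            (mul_nonneg (neg_nonneg.2 hβ.le) hgj'.le)]
      have hP : 0 ≤ ∏ l ∈ Finset.range j, (1 + a l) := Finset.prod_nonneg fun l _ => by linarith [ha0 l]
      calc |gbar β g' j - gbar β g₀ j| * (1 - β j * (gbar β g' j + gbar β g₀ j))
          ≤ (δ * gbar β g' j * ∏ l ∈ Finset.range j, (1 + a l)) * ((1 - β j * gbar β g' j) * (1 + a j)) :=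
            mul_le_mul ih hfac hF0 (by positivity)
        _ = δ * (gbar β g' j * (1 - β j * gbar β g' j)) * ((∏ l ∈ Finset.range j, (1 + a l)) * (1 + a j)) := by
            ring
  -- `∏ (1 + a_l) ≤ 2`
  have hprod : ∀ j, ∏ l ∈ Finset.range j, (1 + a l) ≤ 2 := fun j => by
    have hsum : ∑ l ∈ Finset.range j, a l ≤ 1 / 2 := by
      calc ∑ l ∈ Finset.range j, a l ≤ ∑ l ∈ Finset.range j, max (-β l) 0 * (2 * g₀) :=
            Finset.sum_le_sum fun l _ => mul_le_mul_of_nonneg_left (h.gbar_le_two_mul_init l) (le_max_right _ _)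
        _ = (∑ l ∈ Finset.range j, max (-β l) 0) * (2 * g₀) := by rw [Finset.sum_mul]
        _ ≤ B * (N + 1 / (Ω - 1)) * (2 * g₀) :=
            mul_le_mul_of_nonneg_right (h.sum_negPart_le _) (by linarith [h.g₀_pos])
        _ ≤ 1 / 2 := by nlinarith [h.smallN]
    calc ∏ l ∈ Finset.range j, (1 + a l) ≤ (1 - ∑ l ∈ Finset.range j, a l)⁻¹ :=
          prod_one_add_le_inv_one_sub_sum _ a (fun l _ => ha0 l) (by linarith)
      _ ≤ 2 := by rw [inv_le_comm₀ (by linarith) two_pos]; linarith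
  have := key j
  have hg' := (h'.gbar_pos j).le
  calc |gbar β g' j - gbar β g₀ j| ≤ δ * gbar β g' j * ∏ l ∈ Finset.range j, (1 + a l) := this
    _ ≤ δ * gbar β g' j * 2 := mul_le_mul_of_nonneg_left (hprod j) (by positivity)
    _ = 2 * δ * gbar β g' j := by ring

/-- Consequence of Lemma 2.1(iv) with `δ ≤ 1/4`: the two flows are comparable, `ḡ_j ≤ (3/2)g̊_j`.
[cite: BauerschmidtBrydgesSlade2015Flow, Lemma 2.1(iv)] -/
theorem gbar_le_of_init_close {g' : ℝ} (h' : CutoffGbarHyp β Ω k B c N g') {δ : ℝ} (hδ : 0 ≤ δ)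
    (hδ1 : δ ≤ 1 / 4) (h0 : |g' - g₀| ≤ δ * g') (j : ℕ) : gbar β g₀ j ≤ 3 / 2 * gbar β g' j := by
  have := h.abs_gbar_sub_gbar_le_init h' hδ h0 j
  have hg' := (h'.gbar_pos j).le
  have h2 : 2 * δ * gbar β g' j ≤ 1 / 2 * gbar β g' j := by nlinarith
  linarith [neg_abs_le (gbar β g' j - gbar β g₀ j)]

/-- **[BBS-rg-flow, Lemma 2.3, (2.33) for `ḡ`, Lipschitz form]**: for admissible initial conditions
`g₀, g̊₀` with `|g₀ - g̊₀| ≤ g̊₀/4` (and the smallness `8B²C_{2,0}g̊₀ ≤ 1` making `ḡ_j' ≥ 0`),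
`|ḡ_j(g₀) - ḡ_j(g̊₀)| ≤ 9(g̊_j²/g̊₀²)|g₀ - g̊₀|` — from `ḡ_j' = O(ḡ_j²/ḡ₀²)` ((2.33)) along the segment and
the mean value inequality. [cite: BauerschmidtBrydgesSlade2015Flow, Lemma 2.3, (2.33) and Lemma 3.4 (proof, (3.14))] -/
theorem abs_gbar_sub_gbar_le_sq {g' : ℝ} (h' : CutoffGbarHyp β Ω k B c N g')
    (hmax : CutoffGbarHyp β Ω k B c N (max g₀ g'))
    (hsmall : 8 * B ^ 2 * ((1 + N) / c + N + 2 * Ω / (Ω - 1)) * max g₀ g' ≤ 1)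
    (h0 : |g₀ - g'| ≤ g' / 4) (j : ℕ) :
    |gbar β g₀ j - gbar β g' j| ≤ 9 * (gbar β g' j ^ 2 / g' ^ 2) * |g₀ - g'| := by
  have hg' := h'.g₀_pos; have hg₀ := h.g₀_pos
  -- the segment `[m, M]`, `m = min`, `M = max`, lies in the admissible range
  set m := min g₀ g' with hm
  set M := max g₀ g' with hM
  have hmM : m ≤ M := min_le_max
  have hm0 : 0 < m := lt_min hg₀ hg'
  have hmem : ∀ x ∈ Set.Icc m M, CutoffGbarHyp β Ω k B c N x := fun x hx =>
    hmax.mono (lt_of_lt_of_le hm0 hx.1) hx.2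
  -- derivative bound along the segment: `0 ≤ ḡ_j'(x) ≤ (ḡ_j(x)/x)² ≤ ((3/2)g̊_j/((3/4)g̊₀))² = 4 g̊_j²/g̊₀²`
  have hx34 : ∀ x ∈ Set.Icc m M, 3 / 4 * g' ≤ x := fun x hx => by
    have : m ≥ 3 / 4 * g' := by
      rw [hm]
      rcases le_total g₀ g' with hle | hle
      · rw [min_eq_left hle]; linarith [neg_abs_le (g₀ - g'), abs_nonneg (g₀ - g')]
      · rw [min_eq_right hle]; linarith
    linarith [hx.1]
  have hclose : ∀ x ∈ Set.Icc m M, |g' - x| ≤ 1 / 4 * g' := fun x hx => by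
    have h1 : x ≤ M := hx.2
    have hx1 := hx34 x hx
    rw [_root_.abs_le]; constructor
    · rw [hM] at h1
      rcases le_total g₀ g' with hle | hle
      · rw [max_eq_right hle] at h1; linarith
      · rw [max_eq_left hle] at h1
        have : g₀ - g' ≤ g' / 4 := (le_abs_self _).trans h0
        linarith
    · linarith
  have hbound : ∀ x ∈ Set.Ico m M, ‖gbarDeriv β x j‖ ≤ 9 * (gbar β g' j ^ 2 / g' ^ 2) := by
    intro x hx
    have hxI : x ∈ Set.Icc m M := Set.Ico_subset_Icc_self hx
    have hx' := hmem x hxI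
    have hsx : 8 * B ^ 2 * ((1 + N) / c + N + 2 * Ω / (Ω - 1)) * x ≤ 1 := by
      refine le_trans ?_ hsmall
      have : 0 ≤ 8 * B ^ 2 * ((1 + N) / c + N + 2 * Ω / (Ω - 1)) := by
        have := h.C20_nonneg; positivity
      exact mul_le_mul_of_nonneg_left hxI.2 this
    obtain ⟨hlo, hhi⟩ := hx'.gbarDeriv_mem j
    have hpos := hx'.gbarDeriv_pos hsx j
    rw [Real.norm_eq_abs, abs_of_pos hpos]
    refine hhi.trans ?_
    -- `ḡ_j(x) ≤ (3/2) g̊_j` by Lemma 2.1(iv) (`|g̊₀ - x| ≤ g̊₀/4`), and `x ≥ (3/4)g̊₀`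
    have hcmp := hx'.gbar_le_of_init_close h' (by norm_num : (0:ℝ) ≤ 1 / 4) le_rfl (hclose x hxI) j
    have hxlow := hx34 x hxI
    have hgx := (hx'.gbar_pos j).le; have hgj := (h'.gbar_pos j).le
    have hx0 : 0 < x := lt_of_lt_of_le hm0 hxI.1
    rw [div_pow, div_le_iff₀ (by positivity)]
    have hne : g' ≠ 0 := hg'.ne'
    calc gbar β x j ^ 2 ≤ (3 / 2 * gbar β g' j) ^ 2 := pow_le_pow_left₀ hgx hcmp 2
      _ = 9 * (gbar β g' j ^ 2 / g' ^ 2) * ((3 / 4 * g') ^ 2 * (4 / 9)) := by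
          field_simp; ring
      _ ≤ 9 * (gbar β g' j ^ 2 / g' ^ 2) * (x ^ 2 * 1) := by
          gcongr
          · norm_num
      _ = 9 * (gbar β g' j ^ 2 / g' ^ 2) * x ^ 2 := by ring
  have hderiv : ∀ x ∈ Set.Icc m M, HasDerivWithinAt (fun g => gbar β g j) (gbarDeriv β x j) (Set.Icc m M) x :=
    fun x _ => (hasDerivAt_gbar β j x).hasDerivWithinAt
  have hMVT := norm_image_sub_le_of_norm_deriv_le_segment' hderiv hbound M (Set.right_mem_Icc.2 hmM)
  rw [Real.norm_eq_abs] at hMVT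
  -- `|ḡ_j(M) - ḡ_j(m)| = |ḡ_j(g₀) - ḡ_j(g̊₀)|` and `M - m = |g₀ - g̊₀|`
  have hMm : M - m = |g₀ - g'| := by
    rw [hM, hm]
    rcases le_total g₀ g' with hle | hle
    · rw [max_eq_right hle, min_eq_left hle, abs_of_nonpos (by linarith)]; ring
    · rw [max_eq_left hle, min_eq_right hle, abs_of_nonneg (by linarith)]
  have habs : |gbar β g₀ j - gbar β g' j| = |gbar β M j - gbar β m j| := by
    rw [hM, hm]
    rcases le_total g₀ g' with hle | hle
    · rw [max_eq_right hle, min_eq_left hle, abs_sub_comm]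
    · rw [max_eq_left hle, min_eq_right hle]
  rw [habs, ← hMm]
  exact hMVT

end CutoffGbarHyp


/-! ## Backward solutions of the linear `z̄`- and `μ̄`-recursions with decaying, resp. bounded, data
(the mechanism of Lemma 2.2 / Lemma 4.2 for general sources), and [BBS-rg-flow, Lemma 2.3, (2.33)]
for `z̄, μ̄` in Lipschitz form -/

namespace QuadFlowParams

variable (P : QuadFlowParams) (g₀ : ℝ)

/-- The decaying solution `d_j = -Σ_{l≥j} ∏_{k=j}^l(1 - ζ_kḡ_k)⁻¹ e_l` of `d_{j+1} = (1 - ζ_jḡ_j)d_j + e_j`.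
[cite: BauerschmidtBrydgesSlade2015Flow, Lemma 2.2, (2.14) (with θ_lḡ_l² replaced by a general source)] -/
def bwdZ (e : ℕ → ℝ) (j : ℕ) : ℝ := -∑' l, P.zetaInvProd g₀ j l * e (l + j)

/-- The bounded solution `m_j = -Σ_{l≥j} ∏_{k=j}^l(λ_k - τ_k)⁻¹ f_l` of `m_{j+1} = (λ_j - τ_j)m_j + f_j`.
[cite: BauerschmidtBrydgesSlade2015Flow, Lemma 2.2, (2.19) (with σ_l replaced by a general source)] -/
def bwdMu (f : ℕ → ℝ) (j : ℕ) : ℝ := -∑' l, P.lamInvProd g₀ j l * f (l + j)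

end QuadFlowParams

namespace CutoffQuadHyp

variable {P : QuadFlowParams} {Ω : ℝ} {k : ℕ∞} {B c : ℝ} {N : ℕ} {C lam g₀ : ℝ}
  (h : CutoffQuadHyp P Ω k B c N C lam g₀)
include h

/-- The hypotheses are monotone in `g₀`. [cite: BauerschmidtBrydgesSlade2015Flow, Lemma 2.2 ("if ḡ₀ is sufficiently small")] -/
theorem mono {g : ℝ} (hg : 0 < g) (hle : g ≤ g₀) : CutoffQuadHyp P Ω k B c N C lam g := by
  have hC := h.C_nonneg
  have hx : 0 ≤ (N : ℝ) + 1 / (Ω - 1) := by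
    have : 0 ≤ 1 / (Ω - 1) := div_nonneg zero_le_one (by linarith [h.one_lt]); positivity
  have hS := h.toCutoffGbarHyp.C20_nonneg
  refine ⟨h.toCutoffGbarHyp.mono hg hle, h.one_lt_lam, h.lam_le, hC, h.zeta_exc, h.eta_le, h.gamma_le,
    h.theta_le, h.zeta_le, h.υgg_le, h.υgz_le, h.υgμ_le, h.υzz_le, h.υzμ_le, ?_, ?_, ?_⟩
  · calc 4 * C * g ≤ 4 * C * g₀ := by gcongr
      _ ≤ 1 := h.smallC1
  · calc 8 * C * g * (N + 1 / (Ω - 1)) ≤ 8 * C * g₀ * (N + 1 / (Ω - 1)) := by gcongr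
      _ ≤ 1 := h.smallC2
  · calc 2 * C * g * (1 + 2 * C * ((1 + N) / c + N + 2 * Ω / (Ω - 1)))
        ≤ 2 * C * g₀ * (1 + 2 * C * ((1 + N) / c + N + 2 * Ω / (Ω - 1))) := by gcongr
      _ ≤ (lam - 1) / 2 := h.smallτ

/-! ### The decaying solution of `d_{j+1} = (1 - ζ_jḡ_j)d_j + e_j` for `|e_l| ≤ Eχ_lḡ_l³` -/

/-- Termwise bound. [cite: BauerschmidtBrydgesSlade2015Flow, Lemma 2.2 (proof of (2.15))] -/
theorem abs_bwdZ_term_le {e : ℕ → ℝ} {E : ℝ}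
    (he : ∀ l, |e l| ≤ E * (cutoffWeight Ω k l * gbar P.β g₀ l ^ 3)) (j l : ℕ) :
    |P.zetaInvProd g₀ j l * e (l + j)| ≤ 2 * E * (cutoffWeight Ω k (l + j) * gbar P.β g₀ (l + j) ^ 3) := by
  obtain ⟨h0, h2⟩ := h.zetaInvProd_mem j l
  rw [abs_mul, abs_of_nonneg h0, mul_assoc]
  exact mul_le_mul h2 (he (l + j)) (abs_nonneg _) zero_le_two

/-- Summability. [cite: BauerschmidtBrydgesSlade2015Flow, Lemma 2.2 (proof)] -/
theorem summable_bwdZ_term {e : ℕ → ℝ} {E : ℝ}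
    (he : ∀ l, |e l| ≤ E * (cutoffWeight Ω k l * gbar P.β g₀ l ^ 3)) (j : ℕ) :
    Summable fun l => P.zetaInvProd g₀ j l * e (l + j) :=
  Summable.of_norm_bounded (((h.tsum_weight_mul_gbar_cube_le j).1).mul_left (2 * E)) fun l => by
    rw [Real.norm_eq_abs]; exact h.abs_bwdZ_term_le he j l

/-- The recursion `d_{j+1} = (1 - ζ_jḡ_j)d_j + e_j`. [cite: BauerschmidtBrydgesSlade2015Flow, Lemma 2.2 (proof, first display)] -/
theorem bwdZ_succ {e : ℕ → ℝ} {E : ℝ}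
    (he : ∀ l, |e l| ≤ E * (cutoffWeight Ω k l * gbar P.β g₀ l ^ 3)) (j : ℕ) :
    P.bwdZ g₀ e (j + 1) = (1 - P.ζ j * gbar P.β g₀ j) * P.bwdZ g₀ e j + e j := by
  have hs := h.summable_bwdZ_term he j
  have hc : (1 - P.ζ j * gbar P.β g₀ j) ≠ 0 := by
    linarith [(h.one_sub_zeta_mul_gbar_mem h.zeta_le h.smallC1 j).1]
  have key : P.bwdZ g₀ e j = (1 - P.ζ j * gbar P.β g₀ j)⁻¹ * (P.bwdZ g₀ e (j + 1) - e j) := by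
    rw [QuadFlowParams.bwdZ, QuadFlowParams.bwdZ, hs.tsum_eq_zero_add]
    simp only [zero_add, P.zetaInvProd_zero]
    have h2 : ∑' l, P.zetaInvProd g₀ j (l + 1) * e (l + 1 + j) =
        (1 - P.ζ j * gbar P.β g₀ j)⁻¹ * ∑' l, P.zetaInvProd g₀ (j + 1) l * e (l + (j + 1)) := by
      rw [← tsum_mul_left]
      exact tsum_congr fun l => by rw [P.zetaInvProd_succ, Nat.add_right_comm, Nat.add_assoc]; ring
    rw [h2]; ring
  set Z := P.bwdZ g₀ e (j + 1)
  rw [key]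
  field_simp
  ring

/-- The bound `|d_j| ≤ 4EC_{2,0} χ_jḡ_j²`. [cite: BauerschmidtBrydgesSlade2015Flow, Lemma 2.2, (2.15), and Lemma 2.3, (2.37)] -/
theorem abs_bwdZ_le {e : ℕ → ℝ} {E : ℝ} (hE : 0 ≤ E)
    (he : ∀ l, |e l| ≤ E * (cutoffWeight Ω k l * gbar P.β g₀ l ^ 3)) (j : ℕ) :
    |P.bwdZ g₀ e j| ≤ 4 * E * ((1 + N) / c + N + 2 * Ω / (Ω - 1)) * (cutoffWeight Ω k j * gbar P.β g₀ j ^ 2) := by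
  have hs := h.summable_bwdZ_term he j
  obtain ⟨hsum, htsum⟩ := h.tsum_weight_mul_gbar_cube_le j
  rw [QuadFlowParams.bwdZ, abs_neg]
  calc |∑' l, P.zetaInvProd g₀ j l * e (l + j)| ≤ ∑' l, |P.zetaInvProd g₀ j l * e (l + j)| := by
        have := norm_tsum_le_tsum_norm (f := fun l => P.zetaInvProd g₀ j l * e (l + j))
          (by simpa only [Real.norm_eq_abs] using hs.abs)
        simpa only [Real.norm_eq_abs] using this
    _ ≤ ∑' l, 2 * E * (cutoffWeight Ω k (l + j) * gbar P.β g₀ (l + j) ^ 3) :=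
        Summable.tsum_le_tsum (h.abs_bwdZ_term_le he j) hs.abs (hsum.mul_left _)
    _ = 2 * E * ∑' l, cutoffWeight Ω k (l + j) * gbar P.β g₀ (l + j) ^ 3 := tsum_mul_left
    _ ≤ 2 * E * (2 * ((1 + N) / c + N + 2 * Ω / (Ω - 1)) * (cutoffWeight Ω k j * gbar P.β g₀ j ^ 2)) :=
        mul_le_mul_of_nonneg_left htsum (by positivity)
    _ = _ := by ring

/-- `d_j → 0`. [cite: BauerschmidtBrydgesSlade2015Flow, Lemma 2.2 (z̄_∞ = 0)] -/
theorem tendsto_bwdZ_zero {e : ℕ → ℝ} {E : ℝ} (hE : 0 ≤ E)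
    (he : ∀ l, |e l| ≤ E * (cutoffWeight Ω k l * gbar P.β g₀ l ^ 3)) : Tendsto (P.bwdZ g₀ e) atTop (𝓝 0) := by
  have hwt : Tendsto (fun j => cutoffWeight Ω k j * gbar P.β g₀ j ^ 2) atTop (𝓝 0) := by
    refine squeeze_zero (fun j => by have := (h.weight_pos j).le; positivity) (fun j => ?_)
      h.tendsto_weight_mul_gbar_zero
    have := (h.weight_pos j).le; have := (h.gbar_pos j).le; have := h.gbar_le_half j
    calc cutoffWeight Ω k j * gbar P.β g₀ j ^ 2 = cutoffWeight Ω k j * gbar P.β g₀ j * gbar P.β g₀ j := by ring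
      _ ≤ cutoffWeight Ω k j * gbar P.β g₀ j * 1 := by gcongr; linarith
      _ = _ := mul_one _
  refine squeeze_zero_norm (fun j => (Real.norm_eq_abs _).trans_le (h.abs_bwdZ_le hE he j)) ?_
  simpa using hwt.const_mul (4 * E * ((1 + N) / c + N + 2 * Ω / (Ω - 1)))

/-- A homogeneous solution `D_{j+1} = (1 - ζ_jḡ_j)D_j` tending to `0` vanishes identically (the products
`∏(1 - ζ_iḡ_i) ≥ 1/2` do not decay, Lemma 2.1(iii)(b)). [cite: BauerschmidtBrydgesSlade2015Flow, Lemma 2.2 (uniqueness) and Lemma 2.1(iii)(b)] -/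
theorem homZ_eq_zero {D : ℕ → ℝ} (hD : ∀ j, D (j + 1) = (1 - P.ζ j * gbar P.β g₀ j) * D j)
    (hD0 : Tendsto D atTop (𝓝 0)) : ∀ j, D j = 0 := by
  obtain ⟨s, hsN, hs⟩ := h.zeta_exc
  have hG := h.toCutoffGbarHyp
  have hprod : ∀ j, D j = D 0 * ∏ i ∈ Finset.range j, (1 - P.ζ i * gbar P.β g₀ i) := by
    intro j
    induction j with
    | zero => simp
    | succ j ih => rw [hD, ih, Finset.prod_range_succ]; ring
  have hlow : ∀ j, |D 0| / 2 ≤ |D j| := fun j => by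
    rw [hprod j, abs_mul, abs_of_pos (a := ∏ i ∈ Finset.range j, (1 - P.ζ i * gbar P.β g₀ i))
      (Finset.prod_pos fun i _ => by linarith [(hG.one_sub_zeta_mul_gbar_mem h.zeta_le h.smallC1 i).1])]
    have := hG.half_le_prod_one_sub_zeta_mul_gbar s h.zeta_le hs h.smallC1 (h.smallC2' hsN) (Finset.range j)
    have h0 := abs_nonneg (D 0)
    calc |D 0| / 2 = |D 0| * (1 / 2) := by ring
      _ ≤ _ := mul_le_mul_of_nonneg_left this h0
  have hd0 : D 0 = 0 := by
    by_contra hne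
    have hpos : 0 < |D 0| / 2 := by positivity
    obtain ⟨j, hj⟩ := ((Metric.tendsto_nhds.1 hD0) (|D 0| / 2) hpos).exists
    rw [dist_zero_right, Real.norm_eq_abs] at hj
    linarith [hlow j]
  intro j
  rw [hprod j, hd0, zero_mul]

/-- **Uniqueness**: a solution of `d_{j+1} = (1 - ζ_jḡ_j)d_j + e_j` tending to `0` is the backward solution.
[cite: BauerschmidtBrydgesSlade2015Flow, Lemma 2.2 ("the unique solution which obeys z̄_∞ = 0")] -/
theorem bwdZ_unique {e : ℕ → ℝ} {E : ℝ} (hE : 0 ≤ E)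
    (he : ∀ l, |e l| ≤ E * (cutoffWeight Ω k l * gbar P.β g₀ l ^ 3)) {d : ℕ → ℝ}
    (hd : ∀ j, d (j + 1) = (1 - P.ζ j * gbar P.β g₀ j) * d j + e j) (hd0 : Tendsto d atTop (𝓝 0)) :
    d = P.bwdZ g₀ e := by
  have hD := h.homZ_eq_zero (D := fun j => d j - P.bwdZ g₀ e j)
    (fun j => by
      show d (j + 1) - P.bwdZ g₀ e (j + 1) = (1 - P.ζ j * gbar P.β g₀ j) * (d j - P.bwdZ g₀ e j)
      rw [hd j, h.bwdZ_succ he j]; ring)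
    (by simpa using hd0.sub (h.tendsto_bwdZ_zero hE he))
  funext j
  exact sub_eq_zero.1 (hD j)

/-! ### The bounded solution of `m_{j+1} = (λ_j - τ_j)m_j + f_j` for `|f_l| ≤ Fχ_lḡ_l²` -/

/-- Termwise bound: `|∏(λ-τ)⁻¹ f_{l+j}| ≤ 4F χ_jḡ_j² α^{l+1}`. [cite: BauerschmidtBrydgesSlade2015Flow, Lemma 2.2, (2.20)] -/
theorem abs_bwdMu_term_le {f : ℕ → ℝ} {F : ℝ} (hF : 0 ≤ F)
    (hf : ∀ l, |f l| ≤ F * (cutoffWeight Ω k l * gbar P.β g₀ l ^ 2)) (j l : ℕ) :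
    |P.lamInvProd g₀ j l * f (l + j)| ≤
      4 * F * (cutoffWeight Ω k j * gbar P.β g₀ j ^ 2) * (2 / (1 + lam)) ^ (l + 1) := by
  have hG := h.toCutoffGbarHyp
  obtain ⟨hP0, hP1⟩ := h.lamInvProd_mem j l
  rw [abs_mul, abs_of_nonneg hP0]
  have hmono : cutoffWeight Ω k (l + j) * gbar P.β g₀ (l + j) ^ 2 ≤ 4 * (cutoffWeight Ω k j * gbar P.β g₀ j ^ 2) := by
    have h1 := hG.gbar_le_two_mul (Nat.le_add_left j l)
    have h2 := cutoffWeight_antitone hG.one_le k (Nat.le_add_left j l)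
    have hg := (hG.gbar_pos (l + j)).le; have hwj := (hG.weight_pos j).le
    calc cutoffWeight Ω k (l + j) * gbar P.β g₀ (l + j) ^ 2 ≤ cutoffWeight Ω k j * (2 * gbar P.β g₀ j) ^ 2 :=
          mul_le_mul h2 (pow_le_pow_left₀ hg h1 2) (by positivity) hwj
      _ = _ := by ring
  calc P.lamInvProd g₀ j l * |f (l + j)|
      ≤ (2 / (1 + lam)) ^ (l + 1) * (F * (4 * (cutoffWeight Ω k j * gbar P.β g₀ j ^ 2))) :=
        mul_le_mul hP1 ((hf (l + j)).trans (mul_le_mul_of_nonneg_left hmono hF)) (abs_nonneg _)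
          (pow_nonneg h.alpha_mem.1 _)
    _ = _ := by ring

/-- Summability. [cite: BauerschmidtBrydgesSlade2015Flow, Lemma 2.2 ("geometric convergence")] -/
theorem summable_bwdMu_term {f : ℕ → ℝ} {F : ℝ} (hF : 0 ≤ F)
    (hf : ∀ l, |f l| ≤ F * (cutoffWeight Ω k l * gbar P.β g₀ l ^ 2)) (j : ℕ) :
    Summable fun l => P.lamInvProd g₀ j l * f (l + j) := by
  obtain ⟨hα0, hα1⟩ := h.alpha_mem
  have hg := (summable_geometric_of_lt_one hα0 hα1).mul_left
    (4 * F * (cutoffWeight Ω k j * gbar P.β g₀ j ^ 2) * (2 / (1 + lam)))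
  refine Summable.of_norm_bounded hg fun l => ?_
  rw [Real.norm_eq_abs]
  refine (h.abs_bwdMu_term_le hF hf j l).trans_eq ?_
  ring

/-- The recursion `m_{j+1} = (λ_j - τ_j)m_j + f_j`. [cite: BauerschmidtBrydgesSlade2015Flow, Lemma 2.2, (2.17)] -/
theorem bwdMu_succ {f : ℕ → ℝ} {F : ℝ} (hF : 0 ≤ F)
    (hf : ∀ l, |f l| ≤ F * (cutoffWeight Ω k l * gbar P.β g₀ l ^ 2)) (j : ℕ) :
    P.bwdMu g₀ f (j + 1) = (P.lam j - P.tau g₀ j) * P.bwdMu g₀ f j + f j := by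
  have hs := h.summable_bwdMu_term hF hf j
  have hΛ : P.lam j - P.tau g₀ j ≠ 0 := by linarith [h.lam_sub_tau_ge j, h.one_lt_lam]
  have key : P.bwdMu g₀ f j = (P.lam j - P.tau g₀ j)⁻¹ * (P.bwdMu g₀ f (j + 1) - f j) := by
    rw [QuadFlowParams.bwdMu, QuadFlowParams.bwdMu, hs.tsum_eq_zero_add]
    simp only [zero_add, P.lamInvProd_zero]
    have h2 : ∑' l, P.lamInvProd g₀ j (l + 1) * f (l + 1 + j) =
        (P.lam j - P.tau g₀ j)⁻¹ * ∑' l, P.lamInvProd g₀ (j + 1) l * f (l + (j + 1)) := by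
      rw [← tsum_mul_left]
      exact tsum_congr fun l => by rw [P.lamInvProd_succ, Nat.add_right_comm, Nat.add_assoc]; ring
    rw [h2]; ring
  set M := P.bwdMu g₀ f (j + 1)
  rw [key]
  field_simp
  ring

/-- The bound `|m_j| ≤ (8F/(λ-1)) χ_jḡ_j²`. [cite: BauerschmidtBrydgesSlade2015Flow, Lemma 2.2, (2.20)–(2.21), and Lemma 2.3, (2.40)] -/
theorem abs_bwdMu_le {f : ℕ → ℝ} {F : ℝ} (hF : 0 ≤ F)
    (hf : ∀ l, |f l| ≤ F * (cutoffWeight Ω k l * gbar P.β g₀ l ^ 2)) (j : ℕ) :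
    |P.bwdMu g₀ f j| ≤ 8 * F / (lam - 1) * (cutoffWeight Ω k j * gbar P.β g₀ j ^ 2) := by
  have hs := h.summable_bwdMu_term hF hf j
  have hlam := h.one_lt_lam
  obtain ⟨hα0, hα1⟩ := h.alpha_mem
  set X := cutoffWeight Ω k j * gbar P.β g₀ j ^ 2 with hX
  set α : ℝ := 2 / (1 + lam) with hα
  have hgeo : HasSum (fun l : ℕ => 4 * F * X * α ^ (l + 1)) (8 * F / (lam - 1) * X) := by
    have h1 := (hasSum_geometric_of_lt_one hα0 hα1).mul_left (4 * F * X * α)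
    have hfun : (fun l : ℕ => 4 * F * X * α ^ (l + 1)) = fun l => 4 * F * X * α * α ^ l := by
      funext l; ring
    have hne1 : lam - 1 ≠ 0 := by linarith
    have hne2 : 1 + lam ≠ 0 := by linarith
    have h1α' : 1 - α = (lam - 1) / (1 + lam) := by
      rw [hα, eq_div_iff hne2, sub_mul, div_mul_cancel₀ _ hne2]; ring
    have hval : 4 * F * X * α * (1 - α)⁻¹ = 8 * F / (lam - 1) * X := by
      rw [h1α', inv_div, hα, mul_assoc (4 * F * X), div_mul_div_comm, mul_comm 2 (1 + lam),
        ← div_mul_div_comm, div_self hne2, one_mul]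
      ring
    rw [hfun, ← hval]
    exact h1
  rw [QuadFlowParams.bwdMu, abs_neg]
  calc |∑' l, P.lamInvProd g₀ j l * f (l + j)| ≤ ∑' l, |P.lamInvProd g₀ j l * f (l + j)| := by
        have := norm_tsum_le_tsum_norm (f := fun l => P.lamInvProd g₀ j l * f (l + j))
          (by simpa only [Real.norm_eq_abs] using hs.abs)
        simpa only [Real.norm_eq_abs] using this
    _ ≤ ∑' l : ℕ, 4 * F * X * α ^ (l + 1) :=
        Summable.tsum_le_tsum (fun l => h.abs_bwdMu_term_le hF hf j l) hs.abs hgeo.summable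
    _ = 8 * F / (lam - 1) * X := hgeo.tsum_eq

/-- A homogeneous solution `M_{j+1} = (λ_j - τ_j)M_j` that stays bounded vanishes identically (the
`μ`-direction expands at rate `≥ (1+λ)/2 > 1`). [cite: BauerschmidtBrydgesSlade2015Flow, Lemma 2.2 (uniqueness for μ̄)] -/
theorem homMu_eq_zero {M : ℕ → ℝ} (hM : ∀ j, M (j + 1) = (P.lam j - P.tau g₀ j) * M j)
    (hbdd : ∃ R, ∀ j, |M j| ≤ R) : ∀ j, M j = 0 := by
  obtain ⟨R, hR⟩ := hbdd
  have hlam := h.one_lt_lam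
  set ρ : ℝ := (1 + lam) / 2 with hρ
  have hρ1 : 1 < ρ := by rw [hρ]; linarith
  have hgrow : ∀ j n, ρ ^ n * |M j| ≤ |M (j + n)| := by
    intro j n
    induction n with
    | zero => simp
    | succ n ih =>
      have hge := h.lam_sub_tau_ge (j + n)
      rw [← Nat.add_assoc, hM, abs_mul,
        abs_of_nonneg (show (0 : ℝ) ≤ P.lam (j + n) - P.tau g₀ (j + n) by linarith), pow_succ]
      calc ρ ^ n * ρ * |M j| = ρ * (ρ ^ n * |M j|) := by ring
        _ ≤ (P.lam (j + n) - P.tau g₀ (j + n)) * |M (j + n)| :=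
          mul_le_mul hge ih (by positivity) (by linarith)
  intro j
  by_contra hne
  have hdj : 0 < |M j| := abs_pos.2 hne
  have hpow : Tendsto (fun n : ℕ => ρ ^ n * |M j|) atTop atTop :=
    (tendsto_pow_atTop_atTop_of_one_lt hρ1).atTop_mul_const hdj
  obtain ⟨n, hn⟩ := (hpow.eventually_gt_atTop R).exists
  exact absurd ((hgrow j n).trans (hR (j + n))) (not_le.2 hn)

/-- **Uniqueness**: a BOUNDED solution of `m_{j+1} = (λ_j - τ_j)m_j + f_j` is the backward solution.
[cite: BauerschmidtBrydgesSlade2015Flow, Lemma 2.2 ("the unique solution which obeys the boundary condition μ_∞ = 0")] -/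
theorem bwdMu_unique {f : ℕ → ℝ} {F : ℝ} (hF : 0 ≤ F)
    (hf : ∀ l, |f l| ≤ F * (cutoffWeight Ω k l * gbar P.β g₀ l ^ 2)) {m : ℕ → ℝ}
    (hm : ∀ j, m (j + 1) = (P.lam j - P.tau g₀ j) * m j + f j) (hbdd : ∃ R, ∀ j, |m j| ≤ R) :
    m = P.bwdMu g₀ f := by
  obtain ⟨R, hR⟩ := hbdd
  have hK : 0 ≤ 8 * F / (lam - 1) := div_nonneg (by positivity) (by linarith [h.one_lt_lam])
  have hM := h.homMu_eq_zero (M := fun j => m j - P.bwdMu g₀ f j)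
    (fun j => by
      show m (j + 1) - P.bwdMu g₀ f (j + 1) = (P.lam j - P.tau g₀ j) * (m j - P.bwdMu g₀ f j)
      rw [hm j, h.bwdMu_succ hF hf j]; ring)
    ⟨R + 8 * F / (lam - 1), fun j => by
      have hX : cutoffWeight Ω k j * gbar P.β g₀ j ^ 2 ≤ 1 := by
        have := h.weight_le_one j; have := h.gbar_le_half j
        have := (h.weight_pos j).le; have := (h.gbar_pos j).le
        nlinarith
      calc |m j - P.bwdMu g₀ f j| ≤ |m j| + |P.bwdMu g₀ f j| := abs_sub _ _
        _ ≤ R + 8 * F / (lam - 1) * (cutoffWeight Ω k j * gbar P.β g₀ j ^ 2) := add_le_add (hR j) (h.abs_bwdMu_le hF hf j)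
        _ ≤ R + 8 * F / (lam - 1) * 1 := by gcongr
        _ = _ := by ring⟩
  funext j
  exact sub_eq_zero.1 (hM j)

end CutoffQuadHyp


/-! ### [BBS-rg-flow, Lemma 2.3, (2.33)] for `z̄` and `μ̄`, Lipschitz form: `V̄_j` depends Lipschitz-
continuously on `g₀`, with constants `O(χ_jḡ_j²/ḡ₀²)` -/

/-- The constant of `|z̄_j(g₀) - z̄_j(g̊₀)| ≤ K_z χ_jg̊_j² |g₀ - g̊₀|/g̊₀²`: `K_z = 36C·C_{2,0}(5/2 + 3Z/2)`.
[cite: BauerschmidtBrydgesSlade2015Flow, Lemma 2.3, (2.33) and (2.38)] -/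
def zLipConst (Ω c : ℝ) (N : ℕ) (C : ℝ) : ℝ :=
  36 * C * ((1 + N) / c + N + 2 * Ω / (Ω - 1)) *
    (5 / 2 + 3 * (2 * C * ((1 + N) / c + N + 2 * Ω / (Ω - 1))) / 2)

/-- The constant of `|μ̄_j(g₀) - μ̄_j(g̊₀)| ≤ K_μ χ_jg̊_j² |g₀ - g̊₀|/g̊₀²`.
[cite: BauerschmidtBrydgesSlade2015Flow, Lemma 2.3, (2.33) and (2.40)] -/
def muLipConst (Ω c : ℝ) (N : ℕ) (C lam : ℝ) : ℝ :=
  8 * C * ((9 + zLipConst Ω c N C) *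
      (4 * (C * (3 + 3 * (2 * C * ((1 + N) / c + N + 2 * Ω / (Ω - 1))) +
        (2 * C * ((1 + N) / c + N + 2 * Ω / (Ω - 1))) ^ 2) / 2) / (lam - 1)) +
    (9 + zLipConst Ω c N C + 45 / 4 + zLipConst Ω c N C / 2 +
      27 / 4 * (2 * C * ((1 + N) / c + N + 2 * Ω / (Ω - 1))) +
      5 / 4 * zLipConst Ω c N C * (2 * C * ((1 + N) / c + N + 2 * Ω / (Ω - 1))))) / (lam - 1)

namespace CutoffQuadHyp

variable {P : QuadFlowParams} {Ω : ℝ} {k : ℕ∞} {B c : ℝ} {N : ℕ} {C lam g₀ : ℝ}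
  (h : CutoffQuadHyp P Ω k B c N C lam g₀)
include h

/-- `K_z ≥ 0`. [cite: BauerschmidtBrydgesSlade2015Flow, Lemma 2.3] -/
theorem zLipConst_nonneg : 0 ≤ zLipConst Ω c N C := by
  unfold zLipConst
  have := h.C_nonneg; have := h.toCutoffGbarHyp.C20_nonneg; have := h.Z_nonneg
  positivity

/-- `|μ̄_j| ≤ M_μ ḡ_j` with `M_μ = 4K_σ/(λ-1) ≥ 0`. [cite: BauerschmidtBrydgesSlade2015Flow, Lemma 2.2, (2.21)] -/
theorem abs_mubar_le_Mmu (j : ℕ) :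
    0 ≤ 4 * (C * (3 + 3 * (2 * C * ((1 + N) / c + N + 2 * Ω / (Ω - 1))) +
        (2 * C * ((1 + N) / c + N + 2 * Ω / (Ω - 1))) ^ 2) / 2) / (lam - 1) ∧
      |P.mubar g₀ j| ≤ 4 * (C * (3 + 3 * (2 * C * ((1 + N) / c + N + 2 * Ω / (Ω - 1))) +
        (2 * C * ((1 + N) / c + N + 2 * Ω / (Ω - 1))) ^ 2) / 2) / (lam - 1) * gbar P.β g₀ j := by
  have hK := h.Ksigma_nonneg
  have hM : 0 ≤ 4 * (C * (3 + 3 * (2 * C * ((1 + N) / c + N + 2 * Ω / (Ω - 1))) +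
      (2 * C * ((1 + N) / c + N + 2 * Ω / (Ω - 1))) ^ 2) / 2) / (lam - 1) :=
    div_nonneg (by positivity) (by linarith [h.one_lt_lam])
  refine ⟨hM, (h.abs_mubar_le j).trans (mul_le_mul_of_nonneg_left ?_ hM)⟩
  exact mul_le_of_le_one_left (h.gbar_pos j).le (h.weight_le_one j)

/-- `K_μ ≥ 0`. [cite: BauerschmidtBrydgesSlade2015Flow, Lemma 2.3] -/
theorem muLipConst_nonneg : 0 ≤ muLipConst Ω c N C lam := by
  unfold muLipConst
  have := h.C_nonneg; have := h.Z_nonneg; have := h.zLipConst_nonneg; have hl := h.one_lt_lam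
  have := (h.abs_mubar_le_Mmu 0).1
  refine div_nonneg ?_ (by linarith)
  positivity

/-- **[BBS-rg-flow, Lemma 2.3, (2.33) for `z̄`], Lipschitz form**: for admissible `g, g̊₀` with
`|g - g̊₀| ≤ g̊₀/4` (and the smallness `8B²C_{2,0} max{g, g̊₀} ≤ 1`),
`|z̄_j(g) - z̄_j(g̊₀)| ≤ K_z χ_jg̊_j² |g - g̊₀|/g̊₀²` — the difference solves the `z̄`-recursion with
source `O(χ_jg̊_j|Δḡ_j|) = O(χ_jg̊_j³ |Δg₀|/g̊₀²)` and decays, so it is the backward solution (2.37).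
[cite: BauerschmidtBrydgesSlade2015Flow, Lemma 2.3, (2.33), (2.37)–(2.38)] -/
theorem abs_zbar_sub_zbar_le {g : ℝ} (hg : 0 < g) (hmax : CutoffQuadHyp P Ω k B c N C lam (max g g₀))
    (hsmall : 8 * B ^ 2 * ((1 + N) / c + N + 2 * Ω / (Ω - 1)) * max g g₀ ≤ 1)
    (hclose : |g - g₀| ≤ g₀ / 4) (j : ℕ) :
    |P.zbar g j - P.zbar g₀ j| ≤
      zLipConst Ω c N C * (cutoffWeight Ω k j * gbar P.β g₀ j ^ 2) * (|g - g₀| / g₀ ^ 2) := by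
  have h' : CutoffQuadHyp P Ω k B c N C lam g := hmax.mono hg (le_max_left _ _)
  have hG := h.toCutoffGbarHyp; have hG' := h'.toCutoffGbarHyp; have hGm := hmax.toCutoffGbarHyp
  have hg₀ := h.g₀_pos
  have hC := h.C_nonneg; have hZ0 := h.Z_nonneg; have hS := hG.C20_nonneg
  set δ := |g - g₀| with hδ
  set Z := 2 * C * ((1 + N) / c + N + 2 * Ω / (Ω - 1)) with hZ
  -- `|Δḡ_j| ≤ 9 (g̊_j²/g̊₀²) δ` and `ḡ_j(g) ≤ (3/2) g̊_j`
  have hΔg : ∀ l, |gbar P.β g l - gbar P.β g₀ l| ≤ 9 * (gbar P.β g₀ l ^ 2 / g₀ ^ 2) * δ := fun l =>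
    hG'.abs_gbar_sub_gbar_le_sq hG hGm hsmall hclose l
  have hcmp : ∀ l, gbar P.β g l ≤ 3 / 2 * gbar P.β g₀ l := fun l =>
    hG'.gbar_le_of_init_close hG (by norm_num : (0:ℝ) ≤ 1 / 4) le_rfl
      (by rw [abs_sub_comm]; linarith [hclose]) l
  -- the source `e_l = -θ_l(ḡ_l'² - g̊_l²) - ζ_l(ḡ_l' - g̊_l) z̄_l'`
  set e : ℕ → ℝ := fun l => -P.θ l * (gbar P.β g l ^ 2 - gbar P.β g₀ l ^ 2) -
    P.ζ l * (gbar P.β g l - gbar P.β g₀ l) * P.zbar g l with he_def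
  set E : ℝ := 9 * C * (5 / 2 + 3 * Z / 2) * (δ / g₀ ^ 2) with hE
  have hE0 : 0 ≤ E := by positivity
  have he : ∀ l, |e l| ≤ E * (cutoffWeight Ω k l * gbar P.β g₀ l ^ 3) := by
    intro l
    have hw := (h.weight_pos l).le; have hw1 := h.weight_le_one l
    have hGl := (hG.gbar_pos l).le; have hG'l := (hG'.gbar_pos l).le
    have hz' : |P.zbar g l| ≤ Z * gbar P.β g l := h'.abs_zbar_le' l
    have hΔ := hΔg l; have hc := hcmp l
    have t1 : |P.θ l * (gbar P.β g l ^ 2 - gbar P.β g₀ l ^ 2)| ≤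
        C * cutoffWeight Ω k l * (9 * (gbar P.β g₀ l ^ 2 / g₀ ^ 2) * δ * (5 / 2 * gbar P.β g₀ l)) := by
      rw [abs_mul, sq_sub_sq, abs_mul]
      refine mul_le_mul (h.theta_le l) ?_ (by positivity) (by positivity)
      rw [abs_of_nonneg (by positivity : 0 ≤ gbar P.β g l + gbar P.β g₀ l), mul_comm]
      exact mul_le_mul hΔ (by linarith) (by positivity) (by positivity)
    have t2 : |P.ζ l * (gbar P.β g l - gbar P.β g₀ l) * P.zbar g l| ≤
        C * cutoffWeight Ω k l * (9 * (gbar P.β g₀ l ^ 2 / g₀ ^ 2) * δ) * (Z * (3 / 2 * gbar P.β g₀ l)) := by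
      rw [abs_mul, abs_mul]
      refine mul_le_mul (mul_le_mul (h.zeta_le l) hΔ (abs_nonneg _) (by positivity))
        (hz'.trans (mul_le_mul_of_nonneg_left hc hZ0)) (abs_nonneg _) (by positivity)
    calc |e l| ≤ |-(P.θ l * (gbar P.β g l ^ 2 - gbar P.β g₀ l ^ 2))| +
          |P.ζ l * (gbar P.β g l - gbar P.β g₀ l) * P.zbar g l| := by
          simp only [he_def, neg_mul]; exact abs_sub _ _
      _ = |P.θ l * (gbar P.β g l ^ 2 - gbar P.β g₀ l ^ 2)| +
          |P.ζ l * (gbar P.β g l - gbar P.β g₀ l) * P.zbar g l| := by rw [abs_neg]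
      _ ≤ C * cutoffWeight Ω k l * (9 * (gbar P.β g₀ l ^ 2 / g₀ ^ 2) * δ * (5 / 2 * gbar P.β g₀ l)) +
          C * cutoffWeight Ω k l * (9 * (gbar P.β g₀ l ^ 2 / g₀ ^ 2) * δ) * (Z * (3 / 2 * gbar P.β g₀ l)) :=
          add_le_add t1 t2
      _ = E * (cutoffWeight Ω k l * gbar P.β g₀ l ^ 3) := by
          rw [hE]; field_simp
  -- the difference solves `d_{l+1} = (1 - ζ_l g̊_l) d_l + e_l` and tends to `0`
  set d : ℕ → ℝ := fun l => P.zbar g l - P.zbar g₀ l with hd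
  have hrec : ∀ l, d (l + 1) = (1 - P.ζ l * gbar P.β g₀ l) * d l + e l := fun l => by
    simp only [hd, he_def, h'.zbar_succ l, h.zbar_succ l]; ring
  have hd0 : Tendsto d atTop (𝓝 0) := by simpa using h'.tendsto_zbar_zero.sub h.tendsto_zbar_zero
  have hdeq := h.bwdZ_unique hE0 he hrec hd0
  have := h.abs_bwdZ_le hE0 he j
  rw [← hdeq] at this
  refine this.trans (le_of_eq ?_)
  rw [hE, zLipConst]
  ring

/-- **[BBS-rg-flow, Lemma 2.3, (2.33) for `μ̄`], Lipschitz form**: under the hypotheses of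
`abs_zbar_sub_zbar_le`, `|μ̄_j(g) - μ̄_j(g̊₀)| ≤ K_μ χ_jg̊_j² |g - g̊₀|/g̊₀²` — the difference solves the
`μ̄`-recursion with source `-(τ_j' - τ_j)μ̄_j' + (σ_j' - σ_j) = O(χ_jg̊_j² |Δg₀|/g̊₀²)` and stays bounded,
so it is the backward solution (2.40). [cite: BauerschmidtBrydgesSlade2015Flow, Lemma 2.3, (2.33), (2.39)–(2.40)] -/
theorem abs_mubar_sub_mubar_le {g : ℝ} (hg : 0 < g) (hmax : CutoffQuadHyp P Ω k B c N C lam (max g g₀))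
    (hsmall : 8 * B ^ 2 * ((1 + N) / c + N + 2 * Ω / (Ω - 1)) * max g g₀ ≤ 1)
    (hclose : |g - g₀| ≤ g₀ / 4) (j : ℕ) :
    |P.mubar g j - P.mubar g₀ j| ≤
      muLipConst Ω c N C lam * (cutoffWeight Ω k j * gbar P.β g₀ j ^ 2) * (|g - g₀| / g₀ ^ 2) := by
  have h' : CutoffQuadHyp P Ω k B c N C lam g := hmax.mono hg (le_max_left _ _)
  have hG := h.toCutoffGbarHyp; have hG' := h'.toCutoffGbarHyp; have hGm := hmax.toCutoffGbarHyp
  have hg₀ := h.g₀_pos; have hlam := h.one_lt_lam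
  have hC := h.C_nonneg; have hZ0 := h.Z_nonneg; have hS := hG.C20_nonneg
  have hKz := h.zLipConst_nonneg
  obtain ⟨hM0, -⟩ := h.abs_mubar_le_Mmu 0
  set δ := |g - g₀| with hδ
  set Z := 2 * C * ((1 + N) / c + N + 2 * Ω / (Ω - 1)) with hZ
  set Kz := zLipConst Ω c N C with hKzdef
  set Mμ := 4 * (C * (3 + 3 * Z + Z ^ 2) / 2) / (lam - 1) with hMμ
  set q : ℕ → ℝ := fun l => cutoffWeight Ω k l * gbar P.β g₀ l ^ 2 * (δ / g₀ ^ 2) with hq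
  have hq0 : ∀ l, 0 ≤ q l := fun l => by have := (h.weight_pos l).le; simp only [hq]; positivity
  -- the inputs: `Δḡ`, `Δz̄`, comparison, `z̄'`, `μ̄'` bounds
  have hΔg : ∀ l, |gbar P.β g l - gbar P.β g₀ l| ≤ 9 * (gbar P.β g₀ l ^ 2 / g₀ ^ 2) * δ := fun l =>
    hG'.abs_gbar_sub_gbar_le_sq hG hGm hsmall hclose l
  have hcmp : ∀ l, gbar P.β g l ≤ 3 / 2 * gbar P.β g₀ l := fun l =>
    hG'.gbar_le_of_init_close hG (by norm_num : (0:ℝ) ≤ 1 / 4) le_rfl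
      (by rw [abs_sub_comm]; linarith [hclose]) l
  have hΔz : ∀ l, |P.zbar g l - P.zbar g₀ l| ≤ Kz * (cutoffWeight Ω k l * gbar P.β g₀ l ^ 2) * (δ / g₀ ^ 2) :=
    fun l => h.abs_zbar_sub_zbar_le hg hmax hsmall hclose l
  have hz : ∀ l, |P.zbar g₀ l| ≤ Z * gbar P.β g₀ l := h.abs_zbar_le'
  have hz' : ∀ l, |P.zbar g l| ≤ Z * (3 / 2 * gbar P.β g₀ l) := fun l =>
    (h'.abs_zbar_le' l).trans (mul_le_mul_of_nonneg_left (hcmp l) hZ0)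
  have hμ' : ∀ l, |P.mubar g l| ≤ Mμ := fun l => by
    obtain ⟨-, hb⟩ := h'.abs_mubar_le_Mmu l
    refine hb.trans ?_
    have := hG'.gbar_le_half l; have := (hG'.gbar_pos l).le
    calc Mμ * gbar P.β g l ≤ Mμ * 1 := by gcongr; linarith
      _ = Mμ := mul_one _
  -- source `f_l = -(τ'_l - τ_l) μ̄'_l + (σ'_l - σ_l)`
  set f : ℕ → ℝ := fun l => -(P.tau g l - P.tau g₀ l) * P.mubar g l + (P.sigma g l - P.sigma g₀ l) with hf_def
  set F : ℝ := C * ((9 + Kz) * Mμ + (9 + Kz + 45 / 4 + Kz / 2 + 27 / 4 * Z + 5 / 4 * Kz * Z)) * (δ / g₀ ^ 2)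
    with hF
  have hF0 : 0 ≤ F := by positivity
  have hfb : ∀ l, |f l| ≤ F * (cutoffWeight Ω k l * gbar P.β g₀ l ^ 2) := by
    intro l
    have hw := (h.weight_pos l).le; have hw1 := h.weight_le_one l
    have hGl := (hG.gbar_pos l).le; have hG'l := (hG'.gbar_pos l).le; have hG2 := hG.gbar_le_half l
    have hΔ := hΔg l; have hc := hcmp l; have hdz := hΔz l
    set w := cutoffWeight Ω k l with hw_def
    set G := gbar P.β g₀ l with hG_def
    set G' := gbar P.β g l with hG'_def
    -- a convenient common currency: `X = w G² δ/g₀²`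
    set X := w * G ^ 2 * (δ / g₀ ^ 2) with hX
    have hX0 : 0 ≤ X := by positivity
    have hwΔ : w * |G' - G| ≤ 9 * X := by
      calc w * |G' - G| ≤ w * (9 * (G ^ 2 / g₀ ^ 2) * δ) := mul_le_mul_of_nonneg_left hΔ hw
        _ = 9 * X := by rw [hX]; ring
    have hwdz : w * |P.zbar g l - P.zbar g₀ l| ≤ Kz * X := by
      calc w * |P.zbar g l - P.zbar g₀ l| ≤ 1 * (Kz * (w * G ^ 2) * (δ / g₀ ^ 2)) :=
            mul_le_mul hw1 hdz (abs_nonneg _) zero_le_one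
        _ = Kz * X := by rw [hX]; ring
    -- `|τ' - τ| w⁻¹`-type bounds are awkward; bound the products directly.
    have hτ : |P.tau g l - P.tau g₀ l| ≤ C * (9 + Kz) * X := by
      have e1 : P.tau g l - P.tau g₀ l = P.υgμ l * (G' - G) + P.υzμ l * (P.zbar g l - P.zbar g₀ l) := by
        simp only [QuadFlowParams.tau, hG_def, hG'_def]; ring
      rw [e1]
      calc |P.υgμ l * (G' - G) + P.υzμ l * (P.zbar g l - P.zbar g₀ l)|
          ≤ |P.υgμ l| * |G' - G| + |P.υzμ l| * |P.zbar g l - P.zbar g₀ l| := by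
            refine (abs_add_le _ _).trans (le_of_eq ?_); rw [abs_mul, abs_mul]
        _ ≤ C * w * |G' - G| + C * w * |P.zbar g l - P.zbar g₀ l| :=
            add_le_add (mul_le_mul_of_nonneg_right (h.υgμ_le l) (abs_nonneg _))
              (mul_le_mul_of_nonneg_right (h.υzμ_le l) (abs_nonneg _))
        _ = C * (w * |G' - G|) + C * (w * |P.zbar g l - P.zbar g₀ l|) := by ring
        _ ≤ C * (9 * X) + C * (Kz * X) := add_le_add (mul_le_mul_of_nonneg_left hwΔ hC)
            (mul_le_mul_of_nonneg_left hwdz hC)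
        _ = C * (9 + Kz) * X := by ring
    have hσ : |P.sigma g l - P.sigma g₀ l| ≤ C * (9 + Kz + 45 / 4 + Kz / 2 + 27 / 4 * Z + 5 / 4 * Kz * Z) * X := by
      have e1 : P.sigma g l - P.sigma g₀ l =
          P.η l * (G' - G) + P.γ l * (P.zbar g l - P.zbar g₀ l) - P.υgg l * ((G' - G) * (G' + G)) -
            P.υgz l * (G * (P.zbar g l - P.zbar g₀ l) + (G' - G) * P.zbar g l) -
            P.υzz l * ((P.zbar g l - P.zbar g₀ l) * (P.zbar g l + P.zbar g₀ l)) := by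
        simp only [QuadFlowParams.sigma, hG_def, hG'_def]; ring
      rw [e1]
      have s1 : |P.η l * (G' - G)| ≤ C * (9 * X) := by
        rw [abs_mul]
        calc |P.η l| * |G' - G| ≤ C * w * |G' - G| := mul_le_mul_of_nonneg_right (h.eta_le l) (abs_nonneg _)
          _ = C * (w * |G' - G|) := by ring
          _ ≤ C * (9 * X) := mul_le_mul_of_nonneg_left hwΔ hC
      have s2 : |P.γ l * (P.zbar g l - P.zbar g₀ l)| ≤ C * (Kz * X) := by
        rw [abs_mul]
        calc |P.γ l| * |P.zbar g l - P.zbar g₀ l| ≤ C * w * |P.zbar g l - P.zbar g₀ l| :=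
              mul_le_mul_of_nonneg_right (h.gamma_le l) (abs_nonneg _)
          _ = C * (w * |P.zbar g l - P.zbar g₀ l|) := by ring
          _ ≤ C * (Kz * X) := mul_le_mul_of_nonneg_left hwdz hC
      have s3 : |P.υgg l * ((G' - G) * (G' + G))| ≤ C * (45 / 4 * X) := by
        rw [abs_mul, abs_mul, abs_of_nonneg (by positivity : 0 ≤ G' + G)]
        have hsum : G' + G ≤ 5 / 4 := by linarith
        calc |P.υgg l| * (|G' - G| * (G' + G)) ≤ C * w * (|G' - G| * (5 / 4)) := by
              refine mul_le_mul (h.υgg_le l) (mul_le_mul_of_nonneg_left hsum (abs_nonneg _)) (by positivity)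
                (by positivity)
          _ = C * (w * |G' - G|) * (5 / 4) := by ring
          _ ≤ C * (9 * X) * (5 / 4) := by gcongr
          _ = C * (45 / 4 * X) := by ring
      have s4 : |P.υgz l * (G * (P.zbar g l - P.zbar g₀ l) + (G' - G) * P.zbar g l)| ≤
          C * ((Kz / 2 + 27 / 4 * Z) * X) := by
        rw [abs_mul]
        have i1 : |G * (P.zbar g l - P.zbar g₀ l)| ≤ 1 / 2 * |P.zbar g l - P.zbar g₀ l| := by
          rw [abs_mul, abs_of_nonneg hGl]; exact mul_le_mul_of_nonneg_right hG2 (abs_nonneg _)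
        have i2 : |(G' - G) * P.zbar g l| ≤ |G' - G| * (Z * (3 / 2 * G)) := by
          rw [abs_mul]; exact mul_le_mul_of_nonneg_left (hz' l) (abs_nonneg _)
        calc |P.υgz l| * |G * (P.zbar g l - P.zbar g₀ l) + (G' - G) * P.zbar g l|
            ≤ C * w * (1 / 2 * |P.zbar g l - P.zbar g₀ l| + |G' - G| * (Z * (3 / 2 * G))) :=
              mul_le_mul (h.υgz_le l) ((abs_add_le _ _).trans (add_le_add i1 i2)) (abs_nonneg _) (by positivity)
          _ = C * (1 / 2 * (w * |P.zbar g l - P.zbar g₀ l|) + (w * |G' - G|) * (Z * (3 / 2 * G))) := by ring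
          _ ≤ C * (1 / 2 * (Kz * X) + (9 * X) * (Z * (3 / 2 * (1 / 2)))) := by
              gcongr
          _ = C * ((Kz / 2 + 27 / 4 * Z) * X) := by ring
      have s5 : |P.υzz l * ((P.zbar g l - P.zbar g₀ l) * (P.zbar g l + P.zbar g₀ l))| ≤
          C * (5 / 4 * Kz * Z * X) := by
        rw [abs_mul, abs_mul]
        have i1 : |P.zbar g l + P.zbar g₀ l| ≤ Z * (3 / 2 * G) + Z * G := (abs_add_le _ _).trans (add_le_add (hz' l) (hz l))
        calc |P.υzz l| * (|P.zbar g l - P.zbar g₀ l| * |P.zbar g l + P.zbar g₀ l|)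
            ≤ C * w * (|P.zbar g l - P.zbar g₀ l| * (Z * (3 / 2 * G) + Z * G)) :=
              mul_le_mul (h.υzz_le l) (mul_le_mul_of_nonneg_left i1 (abs_nonneg _)) (by positivity) (by positivity)
          _ = C * (w * |P.zbar g l - P.zbar g₀ l|) * (5 / 2 * Z * G) := by ring
          _ ≤ C * (Kz * X) * (5 / 2 * Z * (1 / 2)) := by gcongr
          _ = C * (5 / 4 * Kz * Z * X) := by ring
      calc |P.η l * (G' - G) + P.γ l * (P.zbar g l - P.zbar g₀ l) - P.υgg l * ((G' - G) * (G' + G)) -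
              P.υgz l * (G * (P.zbar g l - P.zbar g₀ l) + (G' - G) * P.zbar g l) -
              P.υzz l * ((P.zbar g l - P.zbar g₀ l) * (P.zbar g l + P.zbar g₀ l))|
          ≤ |P.η l * (G' - G)| + |P.γ l * (P.zbar g l - P.zbar g₀ l)| + |P.υgg l * ((G' - G) * (G' + G))| +
              |P.υgz l * (G * (P.zbar g l - P.zbar g₀ l) + (G' - G) * P.zbar g l)| +
              |P.υzz l * ((P.zbar g l - P.zbar g₀ l) * (P.zbar g l + P.zbar g₀ l))| :=
            (abs_sub _ _).trans (add_le_add ((abs_sub _ _).trans (add_le_add ((abs_sub _ _).trans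
              (add_le_add (abs_add_le _ _) le_rfl)) le_rfl)) le_rfl)
        _ ≤ C * (9 * X) + C * (Kz * X) + C * (45 / 4 * X) + C * ((Kz / 2 + 27 / 4 * Z) * X) +
              C * (5 / 4 * Kz * Z * X) := by linarith
        _ = C * (9 + Kz + 45 / 4 + Kz / 2 + 27 / 4 * Z + 5 / 4 * Kz * Z) * X := by ring
    calc |f l| ≤ |-((P.tau g l - P.tau g₀ l) * P.mubar g l)| + |P.sigma g l - P.sigma g₀ l| := by
          simp only [hf_def, neg_mul]; exact abs_add_le _ _
      _ = |(P.tau g l - P.tau g₀ l) * P.mubar g l| + |P.sigma g l - P.sigma g₀ l| := by rw [abs_neg]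
      _ ≤ C * (9 + Kz) * X * Mμ + C * (9 + Kz + 45 / 4 + Kz / 2 + 27 / 4 * Z + 5 / 4 * Kz * Z) * X := by
          refine add_le_add ?_ hσ
          rw [abs_mul]; exact mul_le_mul hτ (hμ' l) (abs_nonneg _) (by positivity)
      _ = F * (w * G ^ 2) := by rw [hF, hX]; ring
  -- the difference solves `m_{l+1} = (λ_l - τ_l) m_l + f_l` and is bounded
  set m : ℕ → ℝ := fun l => P.mubar g l - P.mubar g₀ l with hm
  have hrec : ∀ l, m (l + 1) = (P.lam l - P.tau g₀ l) * m l + f l := fun l => by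
    simp only [hm, hf_def, h'.mubar_succ l, h.mubar_succ l]; ring
  have hbdd : ∃ R, ∀ l, |m l| ≤ R := ⟨Mμ + Mμ, fun l => by
    have h1 := hμ' l
    obtain ⟨-, h2⟩ := h.abs_mubar_le_Mmu l
    have h2' : |P.mubar g₀ l| ≤ Mμ := h2.trans (by
      have := hG.gbar_le_half l; have := (hG.gbar_pos l).le
      calc Mμ * gbar P.β g₀ l ≤ Mμ * 1 := by gcongr; linarith
        _ = Mμ := mul_one _)
    exact (abs_sub _ _).trans (add_le_add h1 h2')⟩
  have hmeq := h.bwdMu_unique hF0 hfb hrec hbdd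
  have := h.abs_bwdMu_le hF0 hfb j
  rw [← hmeq] at this
  refine this.trans (le_of_eq ?_)
  rw [hF, hMμ, hZ, hKzdef, muLipConst]
  ring

end CutoffQuadHyp


end CTWSAW

end Literature.Barriers.CriticalPhenomena
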